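import Summits.BirchSwinnertonDyer.BirchSwinnertonDyer.Theses.MockTateDerivative

/-!
# Line `birth` (BC3 skeleton) for crux `MockTateDerivative.BSDOffTateSector`
# (item stmt-BirchSwinnertonDyer-18593, formerly stmt-BirchSwinnertonDyer-18493 before the rev-1 cone repair;
#  route `route-BirchSwinnertonDyer-MockTateDerivative`, crux rank 3, declared RESIDUAL)

Registered by the skeleton registrar `planner-skel-stmt-BirchSwinnertonDyer-18493-0` (2026-08-17).

## The crux (recall)

`BSDOffTateSector`: for every globally minimal elliptic `W/ℚ` with `2 ≤ r_an(W)` that is NOT in the non-split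
Tate sector — there is no prime `p ≥ 5` with `N = p·M`, `p ∤ M`, `W` multiplicative at `p`, the `ℤ_p`-minimal
model NOT split multiplicative, `ρ̄_{W,p}` surjective and `r_an(W) = 2` — one has `r_an(W) = rank_ℤ W(ℚ)`.
It is the declared RESIDUAL of the route: BSD-rank on the complement of the conjunct the route attacks
(`MockNonVanishing` + `VerticalKolyvagin` settle the sector). No mechanism is offered by the route for it.

## The line: the route header's foreseen REGIME SPLIT (`TWO-LAYER PLAN`:
## `BSDOffTateSector ⇐ RankGeThree → RankTwoOffSector (regime split, residual)`)

Two registered stubs, one per analytic-rank regime of the residual; each is BSD-rank on a regime in which the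
conjecture is open in print (only `r_an ≤ 1` is known: Gross–Zagier–Kolyvagin = the route's `RankLeOne`,
tree fact `Literature.NumberTheory.EllipticCurves.rank_eq_analyticRank_of_analyticRank_le_one`), and
neither regime contains the other or the sector:

* **S1 · `stub_rankGeThree`** — BSD-rank for globally minimal `W/ℚ` of analytic rank `≥ 3`
  (e.g. 5077a1, `r_an = 3`, Gross–Zagier / Buhler–Gross–Zagier 1985). The sector clause is vacuous here
  (it forces `r_an = 2`), so it is dropped from the signature. Open problem: no construction of three
  independent points from `L'''(E,1) ≠ 0` is known, and no Selmer-corank upper bound by the COMPLEX order of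
  vanishing exists beyond corank ≤ 1 (Kolyvagin1990; Kato2004 Thm 14.2 bounds by the `p`-adic order).
* **S2 · `stub_rankTwoOffSector`** — for globally minimal `W/ℚ` with `r_an(W) = 2` and NO admissible
  non-split Tate prime (`¬ ∃ p ≥ 5, M` with `N = pM`, `p ∤ M`, multiplicative and non-split at `p`,
  `ρ̄_{W,p}` surjective — the crux's negated existential with its last conjunct `r_an = 2` discharged by the
  regime hypothesis), `rank_ℤ W(ℚ) = 2`. Covers every rank-2 curve all of whose Tate primes `≥ 5` are split
  or have small image, e.g. 389a1 (`N = 389` prime, `a_389 = +1`: split), and every rank-2 curve with no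
  multiplicative prime `≥ 5` at all. Open problem (refuter census j027232: 215 of 551 small rank-2 curves
  with `N ≤ 20000` are off-sector; BSD-rank verified for each by 2-descent, proved for none as a class).

`BSDOffTateSector_of` is sorry-free logic: given `W` with `2 ≤ r_an` off the sector, either `r_an = 2`
(then the crux's negated `∃` with `r_an = 2` appended is S2's negated `∃`, and S2 gives `rank = 2 = r_an`)
or `3 ≤ r_an` (S1).

Disproof.lean: none exists for this crux (`ledger crux ls stmt-BirchSwinnertonDyer-18493 / -18593`: no
workfiles before this one) — no `_false_without_` obstruction to honour, no landed Negative lemma to avoid.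
Negatives index of the summit (`ledger negatives --problem BirchSwinnertonDyer`): one refuted statement
(LeadingTerm `TamePinch`: CM curves admit no admissible surjective good ordinary `p`) — not an instance of
either stub (S1 has no prime at all; S2 only NEGATES the existence of a surjective Tate prime).

BC3 probes (planner folder `bc/probe_S1_crux.lean`, `bc/probe_S1_summit.lean`, `bc/probe_S2_crux.lean`,
`bc/probe_S2_summit.lean`, 2026-08-17, `maxHeartbeats 400000`, the
stub statements copied verbatim, this file NOT imported so that `exact?` cannot chain the sibling stub through
`BSDOffTateSector_of`): for each stub `S`, `S → BSDOffTateSector` and `S → BirchSwinnertonDyer` by the battery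
`first | exact? | simpa | aesop` FAIL — see `Lines/birth.md` for rc and the unsolved goals.
-/

set_option linter.unusedVariables false
set_option linter.dupNamespace false

noncomputable section

namespace Summit.BirchSwinnertonDyer.BirchSwinnertonDyer.Cruxes.BSDOffTateSector.Birth

open scoped Classical
open Summit.BirchSwinnertonDyer.BirchSwinnertonDyer.Theses.MockTateDerivative

/-! ## Registered stubs -/

/-- **S1 · `stub_rankGeThree` — BSD-RANK IN ANALYTIC RANK AT LEAST THREE.** For every globally minimal
elliptic `W/ℚ` with `3 ≤ ord_{s=1} L(W,s)`: `ord_{s=1} L(W,s) = rank_ℤ W(ℚ)`. The whole `r_an ≥ 3` regime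
of the summit (the sector clause of the crux is vacuous there). Open in print: only `r_an ≤ 1` is known
(Gross–Zagier–Kolyvagin); for `r_an ≥ 2` neither inequality is known for a single infinite family.
[cite: Kolyvagin1990] [cite: GrossZagier1986] [cite: SilvermanAEC2009, C.16] [cite: Kato2004, Thm 14.2] -/
theorem stub_rankGeThree :
    ∀ (W : WeierstrassCurve ℚ) [W.IsElliptic] [W.IsGloballyMinimal],
      3 ≤ W.analyticRank → W.analyticRank = W.mordellWeilRank := by
  sorry

/-- **S2 · `stub_rankTwoOffSector` — RANK TWO OFF THE NON-SPLIT TATE SECTOR.** For every globally minimal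
elliptic `W/ℚ` with `ord_{s=1} L(W,s) = 2` admitting NO prime `p ≥ 5` with `N = p·M`, `p ∤ M`, `W`
multiplicative at `p`, the `ℤ_p`-minimal model not split multiplicative and `ρ̄_{W,p} : Γ_ℚ ↠ GL₂(𝔽_p)`
surjective: `rank_ℤ W(ℚ) = 2`. Covers the rank-2 curves whose Tate primes `≥ 5` are all split or of small
image (389a1: `N = 389`, `a_389 = +1`) and those with no Tate prime `≥ 5`. Open in print (the good-ordinary
`p`-converse of CastellaHsieh2022 gives `corank = 2 ⇒ …` directions only under non-vanishing of generalised
Kato classes; nothing produces two independent points from `L''(E,1) ≠ 0`).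
[cite: CastellaHsieh2022] [cite: Kolyvagin1990] [cite: SilvermanAEC2009, C.16] [cite: arXiv:2311.03100, Conj. 2.13] -/
theorem stub_rankTwoOffSector :
    ∀ (W : WeierstrassCurve ℚ) [W.IsElliptic] [W.IsGloballyMinimal],
      W.analyticRank = 2 →
      (¬ ∃ (p M : ℕ) (_ : Fact p.Prime), 5 ≤ p ∧ W.conductorNorm ℤ = p * M ∧ ¬ p ∣ M ∧
          W.HasMultiplicativeReductionAtPrime p ∧
          ¬ ((W.baseChange ℚ_[p]).minimal ℤ_[p]).HasSplitMultiplicativeReduction ℤ_[p] ∧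
          W.HasSurjectiveModNGaloisRep p) →
      W.mordellWeilRank = 2 := by
  sorry

/-! ## Stub statements by name -/

namespace Statement

/-- Statement of `stub_rankGeThree`. -/
abbrev stub_rankGeThree : Prop := type_of% @Birth.stub_rankGeThree
/-- Statement of `stub_rankTwoOffSector`. -/
abbrev stub_rankTwoOffSector : Prop := type_of% @Birth.stub_rankTwoOffSector

end Statement

/-! ## The composition (sorry-free): the two stub STATEMENTS imply the crux, BY NAME -/

/-- **`BSDOffTateSector_of`** — `BSDOffTateSector` from the two regime stubs: split on `r_an = 2` versus
`3 ≤ r_an`. In the first case the crux's negated existential (whose last conjunct is `r_an = 2`) yields S2's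
negated existential and S2 gives `rank = 2 = r_an`; in the second S1 applies verbatim. Pure logic. -/
theorem BSDOffTateSector_of (h3 : Statement.stub_rankGeThree) (h2 : Statement.stub_rankTwoOffSector) :
    BSDOffTateSector := by
  intro W _ _ hge hnot
  by_cases hr : W.analyticRank = 2
  · have hns : ¬ ∃ (p M : ℕ) (_ : Fact p.Prime), 5 ≤ p ∧ W.conductorNorm ℤ = p * M ∧ ¬ p ∣ M ∧
        W.HasMultiplicativeReductionAtPrime p ∧
        ¬ ((W.baseChange ℚ_[p]).minimal ℤ_[p]).HasSplitMultiplicativeReduction ℤ_[p] ∧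
        W.HasSurjectiveModNGaloisRep p := by
      rintro ⟨p, M, hp, h5, hN, hpM, hm, hns, hsurj⟩
      exact hnot ⟨p, M, hp, h5, hN, hpM, hm, hns, hsurj, hr⟩
    rw [hr, h2 W hr hns]
  · exact h3 W (by omega)

/-- The crux along this line, MODULO exactly the two registered stubs (sorries live only in `stub_*`). -/
theorem BSDOffTateSector_proof : BSDOffTateSector :=
  BSDOffTateSector_of stub_rankGeThree stub_rankTwoOffSector

end Summit.BirchSwinnertonDyer.BirchSwinnertonDyer.Cruxes.BSDOffTateSector.Birth

end
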